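import Summits.QuantumFields.QCD.Theorems.HeatSlicedQuarksActionBoundsLowModesStubDominationAux

/-!
# Stub `stub_domination` of line `Sketch` (idea `drop-the-wilson-square`)
(crux `Summit.QuantumFields.QCD.Theses.HeatSlicedQuarks.ActionBoundsLowModes`, item stmt-QuantumFields-8872,
route route-QuantumFields-HeatSlicedQuarks)

**Kato / M-matrix domination of the resolvent of the naive kinetic operator by the free walk.**
For an `SU(3)` link field `U` on `(ℤ/L)⁴`, `ε > 0` and a fermion index `i = (x,a,α)`:
`|((Tn(U) + ε)⁻¹)⁴(i,i)| ≤ ((T₀ + ε)⁻¹)⁴(x,x)`, where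
`Tn(U) = (Σ_μ (F_μ − F_μᴴ)ᴴ(F_μ − F_μᴴ)) ⊗ 1_spin` (`F_μ = linkHop ρ₃ U μ` the `U`-twisted forward
shift on site ⊗ colour) and `T₀` is the free scalar double-step Laplacian
`(T₀ f)(x) = Σ_μ (2 f(x) − f(x + 2μ̂) − f(x − 2μ̂))` (a real matrix).

Proof (all ingredients are in the support file `…StubDominationAux`):
1. *Algebra.* `F_μ` is unitary, so `(F_μ − F_μᴴ)ᴴ(F_μ − F_μᴴ) = 2 − F_μ² − F_μᴴ²` and, with
   `F̃_μ = F_μ ⊗ 1`, `(8 + ε) u = (Tn + ε) u + Σ_μ (F̃_μ(F̃_μ u) + F̃_μᴴ(F̃_μᴴ u))` for every field `u`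
   (`dom_smul_eq_resolvent_add_hops`).
2. *Site norms.* `|u|(y) = √(Σ_{a,α}|u(y,a,α)|²)` is a Euclidean norm of the colour ⊗ spin block; the
   two-link transports are unitary on each block, so `|F̃_μ(F̃_μ u)|(y) = |u|(y + 2μ̂)` and
   `|F̃_μᴴ(F̃_μᴴ u)|(y) = |u|(y − 2μ̂)` (`dom_siteNorm_bigHop_mulVec`,
   `dom_siteNorm_bigHop_conjTranspose_mulVec`).  The triangle inequality gives the key pointwise bound
   `(8 + ε)|u|(y) − Σ_μ (|u|(y + 2μ̂) + |u|(y − 2μ̂)) ≤ |(Tn + ε) u|(y)` (`dom_key`), i.e.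
   `(T₀ + ε)|u| ≤ |(Tn + ε) u|` pointwise (`dom_free_mulVec_apply`).
3. *Maximum principle.* `H₀ = T₀ + ε` satisfies `H₀ f ≥ 0 ⇒ f ≥ 0` (look at a minimum of `f`), hence
   is invertible with monotone inverse: `H₀ f ≤ h ⇒ f ≤ H₀⁻¹ h` (registered sub-goal
   `stub_dominationMaxPrinciple` of the support file).
   `Hc = Tn + ε` is positive definite, hence invertible.
4. *Iteration.* With `u_k = (Hc⁻¹)^k δ_i` one has `Hc u_{k+1} = u_k`, so by 2.–3. and induction
   `|u_k| ≤ (H₀⁻¹)^k |δ_i| = (H₀⁻¹)^k δ_x` pointwise; finally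
   `|((Hc⁻¹)⁴)(i,i)| = |u₄(i)| ≤ |u₄|(x) ≤ ((H₀⁻¹)⁴ δ_x)(x) = ((H₀⁻¹)⁴)(x,x)`.
No path expansion, semigroup or Fourier analysis is used; Mathlib only (plus the tree's
`OverlapLocality` / `KineticEdge` helpers).
-/

namespace Summit.QuantumFields.QCD.Cruxes.ActionBoundsLowModes.DropTheWilsonSquare

open Literature.MathematicalPhysics Literature.MathematicalPhysics.QuantumLattice
  Literature.MathematicalPhysics.QuantumFieldTheory Literature.Probability.LatticeModels
open Matrix
open scoped Kronecker ComplexOrder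

section HopNorms

variable {L N : ℕ} [NeZero L] {G : Type*} [Group G]

/-- `|F̃_μ w|(y) = |w|(y + μ̂)`: the forward hop followed by the site norm. -/
private theorem dom_siteNorm_bigHop_mulVec (ρ : G →* Matrix (Fin N) (Fin N) ℂ)
    (hρ : ∀ g, ρ g ∈ Matrix.unitaryGroup (Fin N) ℂ) (U : GaugeConfig 4 L G) (μ : Fin 4)
    (w : TorusSite 4 L × Fin N × Fin 4 → ℂ) (y : TorusSite 4 L) :
    Real.sqrt (∑ a, ∑ α, ‖(Matrix.reindex (Equiv.prodAssoc _ _ _) (Equiv.prodAssoc _ _ _)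
        (linkHop ρ U μ ⊗ₖ (1 : Matrix (Fin 4) (Fin 4) ℂ)) *ᵥ w) (y, a, α)‖ ^ 2) =
      Real.sqrt (∑ a, ∑ α, ‖w (QuantumFieldTheory.Site.shift y μ, a, α)‖ ^ 2) := by
  simp_rw [Summit.QuantumFields.QCD.Theorems.KineticEdge.reindex_linkHop_kronecker_one_mulVec]
  exact congrArg Real.sqrt (dom_site_sq_colour_rotate (ρ (U (y, μ)))
    (Matrix.mem_unitaryGroup_iff'.mp (hρ _)) (fun b α => w (QuantumFieldTheory.Site.shift y μ, b, α)))

/-- `|F̃_μᴴ w|(y) = |w|(y − μ̂)`: the backward hop followed by the site norm. -/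
private theorem dom_siteNorm_bigHop_conjTranspose_mulVec (ρ : G →* Matrix (Fin N) (Fin N) ℂ)
    (hρ : ∀ g, ρ g ∈ Matrix.unitaryGroup (Fin N) ℂ) (U : GaugeConfig 4 L G) (μ : Fin 4)
    (w : TorusSite 4 L × Fin N × Fin 4 → ℂ) (y : TorusSite 4 L) :
    Real.sqrt (∑ a, ∑ α, ‖((Matrix.reindex (Equiv.prodAssoc _ _ _) (Equiv.prodAssoc _ _ _)
        (linkHop ρ U μ ⊗ₖ (1 : Matrix (Fin 4) (Fin 4) ℂ)))ᴴ *ᵥ w) (y, a, α)‖ ^ 2) =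
      Real.sqrt (∑ a, ∑ α, ‖w (y - Pi.single μ 1, a, α)‖ ^ 2) := by
  simp_rw [dom_bigHop_conjTranspose_mulVec_apply]
  exact congrArg Real.sqrt (dom_site_sq_colour_rotate_star (ρ (U (y - Pi.single μ 1, μ)))
    (Matrix.mem_unitaryGroup_iff.mp (hρ _)) (fun b α => w (y - Pi.single μ 1, b, α)))

/-- **The key pointwise inequality**: for every field `u` and site `y`,
`(8 + ε)|u|(y) − Σ_μ (|u|(y + 2μ̂) + |u|(y − 2μ̂)) ≤ |(Tn + ε) u|(y)`. -/
private theorem dom_key (ρ : G →* Matrix (Fin N) (Fin N) ℂ) (hρ : ∀ g, ρ g ∈ Matrix.unitaryGroup (Fin N) ℂ)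
    (U : GaugeConfig 4 L G) {ε : ℝ} (hε : 0 ≤ ε) (u : TorusSite 4 L × Fin N × Fin 4 → ℂ) (y : TorusSite 4 L) :
    (8 + ε) * Real.sqrt (∑ a, ∑ α, ‖u (y, a, α)‖ ^ 2) -
        ∑ μ : Fin 4, (Real.sqrt (∑ a, ∑ α, ‖u (y + 2 • Pi.single μ 1, a, α)‖ ^ 2) +
          Real.sqrt (∑ a, ∑ α, ‖u (y - 2 • Pi.single μ 1, a, α)‖ ^ 2)) ≤
      Real.sqrt (∑ a, ∑ α, ‖((Matrix.reindex (Equiv.prodAssoc (TorusSite 4 L) (Fin N) (Fin 4))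
            (Equiv.prodAssoc (TorusSite 4 L) (Fin N) (Fin 4))
            ((∑ μ : Fin 4, (linkHop ρ U μ - (linkHop ρ U μ)ᴴ)ᴴ * (linkHop ρ U μ - (linkHop ρ U μ)ᴴ)) ⊗ₖ
              (1 : Matrix (Fin 4) (Fin 4) ℂ)) +
          (ε : ℂ) • (1 : Matrix (TorusSite 4 L × Fin N × Fin 4) (TorusSite 4 L × Fin N × Fin 4) ℂ)) *ᵥ u)
            (y, a, α)‖ ^ 2) := by
  have hid := dom_smul_eq_resolvent_add_hops ρ hρ U ε u
  have h8 : ‖(8 : ℂ) + (ε : ℂ)‖ = 8 + ε := by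
    rw [show (8 : ℂ) + (ε : ℂ) = ((8 + ε : ℝ) : ℂ) by push_cast; ring, Complex.norm_real,
      Real.norm_of_nonneg (by linarith)]
  have h1 := dom_siteNorm_smul ((8 : ℂ) + ε) u y
  rw [h8] at h1
  rw [← h1, sub_le_iff_le_add, hid]
  refine (dom_siteNorm_add_le _ _ y).trans ?_
  apply add_le_add_right
  refine (dom_siteNorm_sum_le _ _ y).trans ?_
  refine Finset.sum_le_sum fun μ _ => ?_
  refine (dom_siteNorm_add_le _ _ y).trans (le_of_eq ?_)
  rw [dom_siteNorm_bigHop_mulVec ρ hρ, dom_siteNorm_bigHop_mulVec ρ hρ,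
    dom_siteNorm_bigHop_conjTranspose_mulVec ρ hρ, dom_siteNorm_bigHop_conjTranspose_mulVec ρ hρ,
    QuantumFieldTheory.Site.shift, QuantumFieldTheory.Site.shift, add_assoc, ← two_nsmul, sub_sub,
    ← two_nsmul]

end HopNorms

/-- **Stub C2a (`stub_domination`, Kato domination of the resolvent fourth power by the free
M-matrix).**  For every field `U`, every `ε > 0` and every index `(x,a,α)`:
`|((Tn(U) + ε)⁻¹)⁴((x,a,α),(x,a,α))| ≤ ((T₀ + ε)⁻¹)⁴(x,x)`, where `T₀` is the free scalar double-step
Laplacian of the torus, `(T₀ f)(x) = Σ_μ (2f(x) − f(x+2μ̂) − f(x−2μ̂))` (a real matrix).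
Proof sketch: `Tn = (8 − Σ_μ(F_μ² + F_μᴴ²)) ⊗ 1` (unitarity of `F_μ`); for `u = (Tn+ε)⁻¹ g` the site norms
`N_u(x) = (Σ_{a,α}|u(x,a,α)|²)^{1/2}` obey `(8+ε)N_u(x) ≤ Σ_μ (N_u(x+2μ̂) + N_u(x−2μ̂)) + N_g(x)` (the
two-link transports are unitary on each colour⊗spin block), i.e. `(T₀+ε)N_u ≤ N_g` pointwise; the maximum
principle gives `(T₀+ε)⁻¹ ≥ 0` entrywise, hence `N_u ≤ (T₀+ε)⁻¹ N_g`; iterate four times from `g = δ_i`. -/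
theorem stub_domination :
    ∀ (L : ℕ) [NeZero L] (U : GaugeConfig 4 L ↥(Matrix.specialUnitaryGroup (Fin 3) ℂ)) (ε : ℝ), 0 < ε →
      ∀ (x : TorusSite 4 L) (a : Fin 3) (α : Fin 4),
        ‖((Matrix.reindex (Equiv.prodAssoc (TorusSite 4 L) (Fin 3) (Fin 4))
                (Equiv.prodAssoc (TorusSite 4 L) (Fin 3) (Fin 4))
              ((∑ μ : Fin 4,
                  (linkHop (fundamentalRep (Fin 3)) U μ - (linkHop (fundamentalRep (Fin 3)) U μ)ᴴ)ᴴ *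
                    (linkHop (fundamentalRep (Fin 3)) U μ - (linkHop (fundamentalRep (Fin 3)) U μ)ᴴ)) ⊗ₖ
                (1 : Matrix (Fin 4) (Fin 4) ℂ)) +
              (ε : ℂ) • (1 : Matrix (TorusSite 4 L × Fin 3 × Fin 4) (TorusSite 4 L × Fin 3 × Fin 4) ℂ))⁻¹ ^ 4)
            (x, a, α) (x, a, α)‖ ≤
          ((Matrix.of (fun x y : TorusSite 4 L => ∑ μ : Fin 4,
                ((if y = x then (2 : ℝ) else 0) - (if y = x + 2 • Pi.single μ 1 then 1 else 0) -
                  (if y = x - 2 • Pi.single μ 1 then 1 else 0))) +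
              ε • (1 : Matrix (TorusSite 4 L) (TorusSite 4 L) ℝ))⁻¹ ^ 4) x x := by
  intro L _ U ε hε x a α
  have hρ : ∀ g, fundamentalRep (Fin 3) g ∈ Matrix.unitaryGroup (Fin 3) ℂ :=
    fundamentalRep_mem_unitaryGroup
  set Hc : Matrix (TorusSite 4 L × Fin 3 × Fin 4) (TorusSite 4 L × Fin 3 × Fin 4) ℂ :=
    Matrix.reindex (Equiv.prodAssoc (TorusSite 4 L) (Fin 3) (Fin 4))
        (Equiv.prodAssoc (TorusSite 4 L) (Fin 3) (Fin 4))
        ((∑ μ : Fin 4,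
          (linkHop (fundamentalRep (Fin 3)) U μ - (linkHop (fundamentalRep (Fin 3)) U μ)ᴴ)ᴴ *
            (linkHop (fundamentalRep (Fin 3)) U μ - (linkHop (fundamentalRep (Fin 3)) U μ)ᴴ)) ⊗ₖ
          (1 : Matrix (Fin 4) (Fin 4) ℂ)) +
      (ε : ℂ) • (1 : Matrix (TorusSite 4 L × Fin 3 × Fin 4) (TorusSite 4 L × Fin 3 × Fin 4) ℂ)
    with hHc
  set H₀ : Matrix (TorusSite 4 L) (TorusSite 4 L) ℝ :=
    Matrix.of (fun x y : TorusSite 4 L => ∑ μ : Fin 4,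
        ((if y = x then (2 : ℝ) else 0) - (if y = x + 2 • Pi.single μ 1 then 1 else 0) -
          (if y = x - 2 • Pi.single μ 1 then 1 else 0))) +
      ε • (1 : Matrix (TorusSite 4 L) (TorusSite 4 L) ℝ) with hH₀
  -- row action of `H₀`
  have hH₀f : ∀ (f : TorusSite 4 L → ℝ) (y : TorusSite 4 L), (H₀ *ᵥ f) y =
      (8 + ε) * f y - ∑ μ : Fin 4, (f (y + 2 • Pi.single μ 1) + f (y - 2 • Pi.single μ 1)) :=
    fun f y => dom_free_mulVec_apply (fun μ : Fin 4 => (2 • Pi.single μ 1 : TorusSite 4 L)) ε f y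
  -- `Hc` is invertible (it is positive definite)
  have hHcinv : Hc * Hc⁻¹ = 1 := by
    have hTn : (Matrix.reindex (Equiv.prodAssoc (TorusSite 4 L) (Fin 3) (Fin 4))
        (Equiv.prodAssoc (TorusSite 4 L) (Fin 3) (Fin 4))
        ((∑ μ : Fin 4,
          (linkHop (fundamentalRep (Fin 3)) U μ - (linkHop (fundamentalRep (Fin 3)) U μ)ᴴ)ᴴ *
            (linkHop (fundamentalRep (Fin 3)) U μ - (linkHop (fundamentalRep (Fin 3)) U μ)ᴴ)) ⊗ₖ
          (1 : Matrix (Fin 4) (Fin 4) ℂ))).PosSemidef := by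
      rw [dom_reindex_sum_kronecker_one]
      refine Matrix.posSemidef_sum _ fun μ _ => ?_
      rw [dom_reindex_mul_kronecker_one, dom_reindex_conjTranspose_kronecker_one]
      exact Matrix.posSemidef_conjTranspose_mul_self _
    have hpd : Hc.PosDef := by
      refine Matrix.PosDef.posSemidef_add hTn ?_
      rw [Matrix.smul_one_eq_diagonal]
      exact Matrix.posDef_diagonal_iff.mpr fun _ => Complex.zero_lt_real.mpr hε
    exact Matrix.mul_nonsing_inv _ ((Matrix.isUnit_iff_isUnit_det _).mp hpd.isUnit)
  -- the key comparison `H₀ |u| ≤ |Hc u|` pointwise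
  have hkey : ∀ (u : TorusSite 4 L × Fin 3 × Fin 4 → ℂ) (y : TorusSite 4 L),
      (H₀ *ᵥ fun z => Real.sqrt (∑ b, ∑ β, ‖u (z, b, β)‖ ^ 2)) y ≤
        Real.sqrt (∑ b, ∑ β, ‖(Hc *ᵥ u) (y, b, β)‖ ^ 2) := by
    intro u y
    rw [hH₀f]
    exact dom_key (fundamentalRep (Fin 3)) hρ U hε.le u y
  -- induction on the power: `|(Hc⁻¹)^k δ_i| ≤ (H₀⁻¹)^k δ_x` pointwise
  have hind : ∀ (k : ℕ) (y : TorusSite 4 L),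
      Real.sqrt (∑ b, ∑ β, ‖((Hc⁻¹ ^ k) *ᵥ Pi.single (x, a, α) 1) (y, b, β)‖ ^ 2) ≤
        ((H₀⁻¹ ^ k) *ᵥ Pi.single x 1) y := by
    intro k
    induction k with
    | zero =>
      intro y
      rw [pow_zero, pow_zero, Matrix.one_mulVec, Matrix.one_mulVec, dom_siteNorm_single]
    | succ k ih =>
      intro y
      rw [pow_succ', ← Matrix.mulVec_mulVec, pow_succ', ← Matrix.mulVec_mulVec]
      refine stub_dominationMaxPrinciple (fun μ : Fin 4 => (2 • Pi.single μ 1 : TorusSite 4 L)) ε hε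
        (fun z => Real.sqrt (∑ b, ∑ β,
          ‖(Hc⁻¹ *ᵥ ((Hc⁻¹ ^ k) *ᵥ Pi.single (x, a, α) 1)) (z, b, β)‖ ^ 2))
        ((H₀⁻¹ ^ k) *ᵥ Pi.single x 1) (fun z => ?_) y
      refine (hkey _ z).trans ?_
      rw [Matrix.mulVec_mulVec, hHcinv, Matrix.one_mulVec]
      exact ih z
  -- conclusion
  have hfin := hind 4 x
  rw [Matrix.mulVec_single_one (M := H₀⁻¹ ^ 4), Matrix.col_apply] at hfin
  calc ‖(Hc⁻¹ ^ 4) (x, a, α) (x, a, α)‖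
      = ‖((Hc⁻¹ ^ 4) *ᵥ Pi.single (x, a, α) 1) (x, a, α)‖ := by
        rw [Matrix.mulVec_single_one, Matrix.col_apply]
    _ ≤ Real.sqrt (∑ b, ∑ β, ‖((Hc⁻¹ ^ 4) *ᵥ Pi.single (x, a, α) 1) (x, b, β)‖ ^ 2) :=
        dom_apply_le_siteNorm _ x a α
    _ ≤ (H₀⁻¹ ^ 4) x x := hfin

end Summit.QuantumFields.QCD.Cruxes.ActionBoundsLowModes.DropTheWilsonSquare
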